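import Literature.AlgebraicGeometry.HodgeTheory.AbelianVarietySubvarietiesFiniteCriterion
import Literature.AlgebraicGeometry.HodgeTheory.AbelianVarietyIsotypicComponentsEndomorphismRing
import Literature.AlgebraicGeometry.Motives.AbelianVarietyImageSimpleProofs
import HarnessLib

/-!
# `End(X)` has no non-zero nilpotents iff `X` is multiplicity-free iff `X` has finitely many abelian subvarieties
# (Mumford §19 Cor. 2: `End⁰(X) = ⊕ M_{n_i}(D_i)` is reduced iff all `n_i = 1`; Zarhin 2008 Thm. 3.2)

Layer `Literature/AlgebraicGeometry/HodgeTheory`; theorems only (no `def`, no instance, no named fact; net debt 0).  §1 holds over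
ANY field: a nilpotent endomorphism of a SIMPLE abelian variety is zero (a non-zero one is an isogeny, and isogenies
compose); for a `Hom`-orthogonal system of simple abelian subvarieties `i_q : Y_q ↪ X` with `⨁ Y_q → X` an isogeny the
restriction homomorphism `End X → Π_q End Y_q` (`…IsotypicComponentsEndomorphismRing.exists_ringHom_end_pi_restrict`) is
injective, so `End X` is reduced; conversely a member `Y_q ∼ B^ι` with two distinct indices carries the non-zero
square-zero endomorphism `X → Y_q → B^ι → B_{k₀} = B_{k₁} → B^ι → Y_q → X`.  §2 combines this, over a PERFECT field, with
`…SubvarietiesFiniteIffMultiplicityFree` ∕ `…SubvarietiesFiniteCriterion`.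

THE PRINT.  Mumford, *Abelian Varieties* §19 Cor. 2 of Thm. 1 (p. 174): `X ∼ ∏ X_i^{n_i}` ⟹ `End⁰(X) = ⊕_i M_{n_i}(D_i)` with
`D_i = End⁰(X_i)` a division algebra — so `End⁰(X)` (equivalently its order `End(X)`, Thm. 3 p. 176: torsion-free) has
non-zero nilpotents iff some `n_i ≥ 2`; Milne 1986 §12 p. 122 (PDF p. 189) and proof of Lemma 12.7 («every non-zero
endomorphism of a simple abelian variety is an isogeny»); Zarhin 2008 Thm. 3.2 (p. 7; Lenstra–Oort–Zarhin 1996) for the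
finiteness of abelian subvarieties up to `Aut(X)`, whose absolute form is `…SubvarietiesFiniteCriterion`.

Results (namespace `Literature.AlgebraicGeometry.HodgeTheory.AbelianVariety`):
* §1 (any field) `isIsogeny_pow_of_isIsogeny`, **`eq_zero_of_isNilpotent_end_of_isSimple`**, `isReduced_end_of_isSimple`,
  **`isReduced_end_of_isSimple_components`** (multiplicity-free systems have reduced `End X`),
  **`exists_ne_zero_comp_self_eq_zero_of_component`** (a member `Y_q ∼ B^ι`, `k₀ ≠ k₁`, `0 < dim B` ⟹ a non-zero `φ`
  with `φ ≫ φ = 0`), `not_isReduced_end_of_component`, `not_isReduced_end_biprod_self` (`B ⊞ B`);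
* §2 `not_isReduced_end_of_one_le_multiplicity`, **`isReduced_end_iff_forall_multiplicity_eq_zero`** (perfect field,
  isotypic components `Y_q ∼ B_q^{n_q+1}`), **`isReduced_end_iff_finite_setOf_range_subvariety`**,
  **`finite_setOf_range_subvariety_iff_isReduced_end`** (perfect field, every `X`: finitely many abelian subvarieties ⟺
  `End X` has no non-zero nilpotent), `isReduced_end_iff_exists_isIsogenous_biproduct_simple`.

## References
* [MumfordAV1970] D. Mumford, *Abelian Varieties* (1970), §19 Thm. 1, Cor. 1–2, Thm. 3 (pp. 173–176).
* [Milne1986AbelianVarieties] J. S. Milne, *Abelian Varieties*, in Cornell–Silverman (1986), §12 p. 122 and Lemma 12.7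
  (PDF pp. 189, 193).
* [Zarhin2008HomomorphismsFiniteFields] Yu. G. Zarhin, *Homomorphisms of abelian varieties over finite fields* (2008)
  (arXiv:0711.1615), Thm. 3.2 (p. 7).
* [Shimura1998] G. Shimura, *Abelian Varieties with Complex Multiplication and Modular Functions* (1998), §5.1 Prop. 3–4.
-/

noncomputable section

universe u

open CategoryTheory CategoryTheory.Limits

namespace Literature.AlgebraicGeometry.HodgeTheory

namespace AbelianVariety

open _root_.AlgebraicGeometry
open Literature.AlgebraicGeometry.Motives Literature.AlgebraicGeometry.Motives.AbelianVariety

variable {K : Type u} [Field K]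

/-! ## §1 Nilpotent endomorphisms (any field) -/

section AnyField

variable {X : Motives.AbelianVariety K}

/-- Powers of an isogeny `α ∈ End Y` are isogenies. [cite: MumfordAV1970, §19 Remark p. 169] -/
theorem isIsogeny_pow_of_isIsogeny {Y : Motives.AbelianVariety K} {α : End Y} (hα : IsIsogeny (End.asHom α)) :
    ∀ k : ℕ, IsIsogeny (End.asHom (α ^ k))
  | 0 => by
    rw [pow_zero]
    exact isIsogeny_id Y
  | k + 1 => by
    rw [pow_succ, End.mul_def]
    exact isIsogeny_comp hα (isIsogeny_pow_of_isIsogeny hα k)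

/-- **A nilpotent endomorphism of a simple abelian variety is zero** (any field): a non-zero endomorphism of a simple
abelian variety is an isogeny, and so are its powers. [cite: Milne1986AbelianVarieties, §12 proof of Lemma 12.7 (PDF p. 193)]
[cite: MumfordAV1970, §19 Cor. 2 of Thm. 1 (p. 174: `End⁰` of a simple abelian variety is a division algebra)] -/
theorem eq_zero_of_isNilpotent_end_of_isSimple {Y : Motives.AbelianVariety K} (hY : Y.IsSimple) {α : End Y}
    (h : IsNilpotent α) : α = 0 := by
  by_contra hα
  obtain ⟨k, hk⟩ := h
  rcases Nat.eq_zero_or_pos Y.dim with h0 | hpos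
  · exact hα (hom_eq_zero_of_dim_eq_zero (Or.inl h0) (End.asHom α))
  · have hiso := isIsogeny_pow_of_isIsogeny (isIsogeny_of_isSimple_of_ne_zero_end hY (End.asHom α) hα) k
    rw [hk] at hiso
    exact not_isIsogeny_zero_of_dim_pos hpos hiso

/-- `End X` of a simple abelian variety is reduced. [cite: MumfordAV1970, §19 Cor. 2 of Thm. 1 (p. 174)] -/
theorem isReduced_end_of_isSimple (hX : X.IsSimple) : _root_.IsReduced (End X) :=
  ⟨fun _ h ↦ eq_zero_of_isNilpotent_end_of_isSimple hX h⟩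

variable {Q : Type} [Fintype Q] {Y : Q → Motives.AbelianVariety K}

/-- **MULTIPLICITY-FREE ⟹ `End X` IS REDUCED** (any field): for a `Hom`-orthogonal system of SIMPLE abelian subvarieties
`i_q : Y_q ↪ X` with `⨁ Y_q → X` an isogeny, a nilpotent `φ ∈ End X` restricts to nilpotent, hence zero, `φ_q ∈ End Y_q`,
so `i_q ≫ φ = 0` for all `q` and `φ = 0`. [cite: MumfordAV1970, §19 Cor. 2 of Thm. 1 (p. 174: `End⁰(X) = ⊕ D_i` for `n_i = 1`)]
[cite: Milne1986AbelianVarieties, §12 p. 122 (PDF p. 189)] -/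
theorem isReduced_end_of_isSimple_components (i : ∀ q, Y q ⟶ X) (hi : ∀ q, IsClosedImmersion (Hom.toSchemeHom (i q)))
    (hdesc : IsIsogeny (biproduct.desc i)) (horth : ∀ q q', q ≠ q' → ∀ f : Y q ⟶ Y q', f = 0)
    (hYs : ∀ q, (Y q).IsSimple) : _root_.IsReduced (End X) := by
  obtain ⟨ρ, hρ⟩ := exists_ringHom_end_pi_restrict i hi hdesc horth
  refine ⟨fun φ hφ ↦ ?_⟩
  have hq : ∀ q, ρ φ q = 0 := fun q ↦ by
    refine eq_zero_of_isNilpotent_end_of_isSimple (hYs q) ?_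
    obtain ⟨k, hk⟩ := hφ.map ρ
    exact ⟨k, by rw [← Pi.pow_apply, hk, Pi.zero_apply]⟩
  refine hom_eq_zero_of_forall_component_comp_eq_zero i hdesc (End.asHom φ) fun q ↦ ?_
  rw [← hρ φ q, hq q]
  exact zero_comp

omit [Fintype Q] in
/-- **A REPEATED FACTOR GIVES A NON-ZERO SQUARE-ZERO ENDOMORPHISM** (any field): if a member `Y_q ∼ B^ι` of a family of
abelian subvarieties `i_q : Y_q ↪ X` with `⨁ Y_q → X` an isogeny has two distinct indices `k₀ ≠ k₁` and `0 < dim B`,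
then `φ = (X → Y_q → B^ι → B_{k₀}) ≫ (B_{k₁} → B^ι → Y_q ↪ X)` satisfies `φ ≠ 0`, `φ ≫ φ = 0` (the matrix unit `E_{k₁ k₀}`
of `M_n(D)`, `n ≥ 2`). [cite: MumfordAV1970, §19 Cor. 2 of Thm. 1 (p. 174) and Remark p. 169]
[cite: Milne1986AbelianVarieties, §12 p. 122 (PDF p. 189: `End⁰(A_i^{r_i}) = M_{r_i}(End⁰ A_i)`)] -/
theorem exists_ne_zero_comp_self_eq_zero_of_component [Fintype Q] (i : ∀ q, Y q ⟶ X)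
    (hi : ∀ q, IsClosedImmersion (Hom.toSchemeHom (i q))) (hdesc : IsIsogeny (biproduct.desc i)) {q : Q}
    {B : Motives.AbelianVariety K} {ι : Type} [Fintype ι] (hY : IsIsogenous (Y q) (⨁ fun _ : ι ↦ B)) {k₀ k₁ : ι}
    (hk : k₀ ≠ k₁) (hB : 0 < B.dim) : ∃ φ : X ⟶ X, φ ≠ 0 ∧ φ ≫ φ = 0 := by
  classical
  obtain ⟨v, m, hm, hdv, -⟩ := IsIsogeny.exists_nsmul_inverse_holds hdesc
  obtain ⟨e, he⟩ := hY
  obtain ⟨w, N, hN, -, hwe⟩ := IsIsogeny.exists_nsmul_inverse_holds he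
  set a : X ⟶ B := v ≫ biproduct.π Y q ≫ e ≫ biproduct.π (fun _ : ι ↦ B) k₀ with ha
  set b : B ⟶ X := biproduct.ι (fun _ : ι ↦ B) k₁ ≫ w ≫ i q with hb
  have h1 : ∀ {W : Motives.AbelianVariety K} (f : Y q ⟶ W), i q ≫ v ≫ biproduct.π Y q ≫ f = m • f := fun f ↦ by
    rw [← Category.assoc v, ← Category.assoc (i q), comp_quasiInverse_π_self i hdv q, Preadditive.nsmul_comp,
      Category.id_comp]
  have h2 : ∀ {W : Motives.AbelianVariety K} (f : (⨁ fun _ : ι ↦ B) ⟶ W), w ≫ e ≫ f = N • f := fun f ↦ by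
    rw [← Category.assoc, hwe, Preadditive.nsmul_comp, Category.id_comp]
  have key : ∀ k : ι, (biproduct.ι (fun _ : ι ↦ B) k ≫ w ≫ i q) ≫ a =
      (m * N) • (biproduct.ι (fun _ : ι ↦ B) k ≫ biproduct.π (fun _ : ι ↦ B) k₀) := fun k ↦ by
    simp only [ha, Category.assoc]
    rw [h1, Preadditive.comp_nsmul, Preadditive.comp_nsmul, h2, Preadditive.comp_nsmul, smul_smul]
  have hba : b ≫ a = 0 := by
    rw [hb, key k₁, biproduct.ι_π_ne _ hk.symm, smul_zero]
  have hb'a : (biproduct.ι (fun _ : ι ↦ B) k₀ ≫ w ≫ i q) ≫ a = (m * N) • 𝟙 B := by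
    rw [key k₀, biproduct.ι_π_self]
  have hbne : b ≠ 0 := by
    haveI := isFinite_toSchemeHom_biproduct_ι (fun _ : ι ↦ B) k₁
    haveI : IsFinite (Hom.toSchemeHom w) := isFinite_of_comp_eq_nsmul_id hN.ne' hwe
    haveI := hi q
    haveI : IsFinite (Hom.toSchemeHom (w ≫ i q)) := isFinite_toSchemeHom_comp _ _
    haveI : IsFinite (Hom.toSchemeHom (biproduct.ι (fun _ : ι ↦ B) k₁ ≫ w ≫ i q)) := isFinite_toSchemeHom_comp _ _
    rw [hb]
    exact ne_zero_of_isFinite _ hB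
  refine ⟨a ≫ b, fun h0 ↦ ?_, ?_⟩
  · have hmN : (m * N) • b = 0 := by
      rw [← Category.id_comp b, ← Preadditive.nsmul_comp, ← hb'a, Category.assoc, h0, comp_zero]
    exact hbne (hom_eq_zero_of_nsmul_eq_zero (Nat.mul_ne_zero hm.ne' hN.ne') hmN)
  · rw [Category.assoc, ← Category.assoc b a b, hba, zero_comp, comp_zero]

omit [Fintype Q] in
/-- `End X` is NOT reduced when a member `Y_q ∼ B^ι` has two distinct indices and `0 < dim B`.
[cite: MumfordAV1970, §19 Cor. 2 of Thm. 1 (p. 174)] [cite: Milne1986AbelianVarieties, §12 p. 122 (PDF p. 189)] -/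
theorem not_isReduced_end_of_component [Fintype Q] (i : ∀ q, Y q ⟶ X) (hi : ∀ q, IsClosedImmersion (Hom.toSchemeHom (i q)))
    (hdesc : IsIsogeny (biproduct.desc i)) {q : Q} {B : Motives.AbelianVariety K} {ι : Type} [Fintype ι]
    (hY : IsIsogenous (Y q) (⨁ fun _ : ι ↦ B)) {k₀ k₁ : ι} (hk : k₀ ≠ k₁) (hB : 0 < B.dim) : ¬ _root_.IsReduced (End X) := by
  obtain ⟨φ, hφ, h2⟩ := exists_ne_zero_comp_self_eq_zero_of_component i hi hdesc hY hk hB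
  intro hR
  exact hφ (hR.eq_zero (End.of φ) ⟨2, by rw [pow_two, End.mul_def]; exact h2⟩)

/-- `End (B ⊞ B)` is not reduced for `0 < dim B`: `(x, y) ↦ (y, 0)` squares to zero. [cite: MumfordAV1970, §19 Cor. 2 of Thm. 1 (p. 174)] -/
theorem not_isReduced_end_biprod_self {B : Motives.AbelianVariety K} (hB : 0 < B.dim) :
    ¬ _root_.IsReduced (End (B ⊞ B)) := by
  intro hR
  set φ : B ⊞ B ⟶ B ⊞ B := biprod.snd ≫ biprod.inl with hφ
  have h2 : φ ≫ φ = 0 := by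
    rw [hφ, Category.assoc, biprod.inl_snd_assoc, zero_comp, comp_zero]
  have h0 : φ = 0 := hR.eq_zero (End.of φ) ⟨2, by rw [pow_two, End.mul_def]; exact h2⟩
  have hinl : (biprod.inl : B ⟶ B ⊞ B) = 0 := by
    rw [← Category.id_comp biprod.inl, ← biprod.inr_snd, Category.assoc, ← hφ, h0, comp_zero]
  haveI := isClosedImmersion_toSchemeHom_biprod_inl B B
  exact ne_zero_of_isFinite (biprod.inl : B ⟶ B ⊞ B) hB hinl

end AnyField

/-! ## §2 Isotypic components and the criteria -/

section Components

variable {Q : Type} [Fintype Q] {B : Q → Motives.AbelianVariety K} {n : Q → ℕ} {X : Motives.AbelianVariety K}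
  {Y : Q → Motives.AbelianVariety K}

/-- A component of multiplicity `≥ 2` (`n_q ≥ 1`, `0 < dim B_q`) makes `End X` non-reduced (any field).
[cite: MumfordAV1970, §19 Cor. 2 of Thm. 1 (p. 174)] [cite: Milne1986AbelianVarieties, §12 p. 122 (PDF p. 189)] -/
theorem not_isReduced_end_of_one_le_multiplicity (hY : ∀ q, IsIsogenous (Y q) (⨁ fun _ : Fin (n q + 1) ↦ B q))
    (i : ∀ q, Y q ⟶ X) (hi : ∀ q, IsClosedImmersion (Hom.toSchemeHom (i q))) (hdesc : IsIsogeny (biproduct.desc i))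
    {q : Q} (hq : 1 ≤ n q) (hB0 : 0 < (B q).dim) : ¬ _root_.IsReduced (End X) :=
  not_isReduced_end_of_component i hi hdesc (hY q) (k₀ := (⟨0, by omega⟩ : Fin (n q + 1)))
    (k₁ := (⟨1, by omega⟩ : Fin (n q + 1))) (Fin.ne_of_val_ne (by norm_num)) hB0

variable [PerfectField K]

/-- **`End X` IS REDUCED IFF `X` IS MULTIPLICITY-FREE** (perfect field; isotypic components `Y_q ∼ B_q^{n_q+1}`, `B_q` simple
of positive dimension pairwise non-isogenous, addition map an isogeny): `IsReduced (End X) ⟺ ∀ q, n_q = 0`.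
[cite: MumfordAV1970, §19 Cor. 2 of Thm. 1 (p. 174)] [cite: Milne1986AbelianVarieties, §12 p. 122 (PDF p. 189)] -/
theorem isReduced_end_iff_forall_multiplicity_eq_zero (hB : ∀ q, (B q).IsSimple) (hB0 : ∀ q, 0 < (B q).dim)
    (hni : ∀ q q', q ≠ q' → ¬ IsIsogenous (B q) (B q')) (hY : ∀ q, IsIsogenous (Y q) (⨁ fun _ : Fin (n q + 1) ↦ B q))
    (i : ∀ q, Y q ⟶ X) (hi : ∀ q, IsClosedImmersion (Hom.toSchemeHom (i q))) (hdesc : IsIsogeny (biproduct.desc i)) :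
    _root_.IsReduced (End X) ↔ ∀ q, n q = 0 := by
  constructor
  · intro hR q
    by_contra hq
    exact not_isReduced_end_of_one_le_multiplicity hY i hi hdesc (Nat.one_le_iff_ne_zero.2 hq) (hB0 q) hR
  · intro h0
    have hYB : ∀ q, IsIsogenous (Y q) (B q) := fun q ↦ by
      have hd : (Y q).dim = (B q).dim := by
        rw [dim_eq_mul_of_isIsogenous_biproduct_const (hY q), h0 q, zero_add, one_mul]
      exact isIsogenous_of_isIsogenous_biproduct_const_of_dim_le (hY q) (by rw [hd]; exact hB0 q) hd.le
    have horth : ∀ q q', q ≠ q' → ∀ f : Y q ⟶ Y q', f = 0 := fun q q' hqq' f ↦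
      hom_eq_zero_of_isIsogenous_biproduct_const_of_ne hB hB0 hni hqq' (hY q) (hY q') f
    exact isReduced_end_of_isSimple_components i hi hdesc horth fun q ↦ (hYB q).isSimple_symm (hB q)

/-- **`End X` is reduced iff `X` has finitely many abelian subvarieties** (perfect field, isotypic components as above).
[cite: MumfordAV1970, §19 Cor. 1–2 of Thm. 1 (pp. 173–174)] [cite: Zarhin2008HomomorphismsFiniteFields, Thm. 3.2 (p. 7)] -/
theorem isReduced_end_iff_finite_setOf_range_subvariety (hB : ∀ q, (B q).IsSimple) (hB0 : ∀ q, 0 < (B q).dim)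
    (hni : ∀ q q', q ≠ q' → ¬ IsIsogenous (B q) (B q')) (hY : ∀ q, IsIsogenous (Y q) (⨁ fun _ : Fin (n q + 1) ↦ B q))
    (i : ∀ q, Y q ⟶ X) (hi : ∀ q, IsClosedImmersion (Hom.toSchemeHom (i q))) (hdesc : IsIsogeny (biproduct.desc i)) :
    _root_.IsReduced (End X) ↔ {R : Set X.X.left | ∃ (Z : Motives.AbelianVariety K) (j : Z ⟶ X),
        IsClosedImmersion (Hom.toSchemeHom j) ∧ R = Set.range (Hom.toSchemeHom j)}.Finite := by
  rw [isReduced_end_iff_forall_multiplicity_eq_zero hB hB0 hni hY i hi hdesc,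
    finite_setOf_range_subvariety_iff_forall_multiplicity_eq_zero hB hB0 hni hY i hi hdesc]

/-- **AN ABELIAN VARIETY HAS FINITELY MANY ABELIAN SUBVARIETIES IFF ITS ENDOMORPHISM RING HAS NO NON-ZERO NILPOTENTS**
(perfect field; every `X`, through its isotypic components). [cite: MumfordAV1970, §19 Cor. 1–2 of Thm. 1 (pp. 173–174)]
[cite: Zarhin2008HomomorphismsFiniteFields, Thm. 3.2 (p. 7)] [cite: Milne1986AbelianVarieties, §12 Prop. 12.1 and p. 122 (PDF p. 189)] -/
theorem finite_setOf_range_subvariety_iff_isReduced_end (X : Motives.AbelianVariety K) :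
    {R : Set X.X.left | ∃ (Z : Motives.AbelianVariety K) (j : Z ⟶ X),
        IsClosedImmersion (Hom.toSchemeHom j) ∧ R = Set.range (Hom.toSchemeHom j)}.Finite ↔ _root_.IsReduced (End X) := by
  obtain ⟨r, B, n, Y, i, hB, hB0, hni, hi, hY, -, hdesc, -⟩ := exists_isotypicComponents_orthogonal X
  rw [isReduced_end_iff_finite_setOf_range_subvariety hB hB0 hni hY i hi hdesc]

/-- `End X` is reduced iff `X ∼ ⨁_{q < r} B_q` with the `B_q` simple of positive dimension and pairwise non-isogenous
(perfect field). [cite: MumfordAV1970, §19 Cor. 1–2 of Thm. 1 (pp. 173–174)] -/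
theorem isReduced_end_iff_exists_isIsogenous_biproduct_simple (X : Motives.AbelianVariety K) :
    _root_.IsReduced (End X) ↔ ∃ (r : ℕ) (B : Fin r → Motives.AbelianVariety K), (∀ q, (B q).IsSimple) ∧ (∀ q, 0 < (B q).dim) ∧
      (∀ q q', q ≠ q' → ¬ IsIsogenous (B q) (B q')) ∧ IsIsogenous X (⨁ B) := by
  rw [← finite_setOf_range_subvariety_iff_isReduced_end,
    finite_setOf_range_subvariety_iff_exists_isIsogenous_biproduct_simple]

end Components

end AbelianVariety

end Literature.AlgebraicGeometry.HodgeTheory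

end
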